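import Summits.Parity.GeneralizedHardyLittlewood.Theorems.PrimeLevelFamEdgeMomentsBeyondDiagonalDiagDecorKappaCrudeCollapse
import Summits.Parity.GeneralizedHardyLittlewood.Theorems.PrimeLevelFamEdgeMomentsBeyondDiagonalDiagDecorShiftedBlockDecorTwoSel
import HarnessLib

/-!
# Route `PrimeLevelFamEdge`, crux K_A `MomentsBeyondDiagonal` (stmt-Parity-20007), line «petersson_layers» v4, stub `stub_diag`:
# **the two-sided `M₄ ⊗ P₂` shifted BLOCK is `O(log^{p+r₁+r₂+2}M)`:
# `|Sel(τ(3P₂²−2P₄)(k₁)ℓ⁺(k₁)^{r₁}·τP₂(k₂)ℓ⁺(k₂)^{r₂}·B^p)| ≤ C·log^{p+r₁+r₂+2}M`**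

The block layer of the ONE new engine (M4P2) asked for by rung 3 of `stub_diag` (hypothesis `hM4P2` of
`…DiagDecorOrderThreeThreePoly.orderThreeThreePoly_of_M4P2`, also of `…DiagDecorOrderTwoFourTarget`): the exact two-sided
expansion `…DiagDecorShiftedBlockDecorTwoSel.selbergBlockDecorTwo_expand` along `B = (λlog M − log(M/(cg))) − log g`
(decorations `D₁ = 3P₂² − 2P₄` on `k₁`, `D₂ = P₂` on `k₂`), the crude coordinate sizes
`|T_{M₄}^{[r₁]}(M;n)| ≤ K₁D(n)(1+κ(n))log^{r₁+1}M` (`…DiagDecorM4Coord.abs_shiftedCoordM4_le` — the `M₄`-cancellation, one log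
below trivial, NO main term) and `|T_{P₂}^{[r₂]}(M;n)| ≤ K₂D(n)log^{r₂}M` (`…ShiftedBlockDecorSel.abs_shiftedCoordPrimeSq_sub_le` +
`…DecorLogGMonomial.abs_profileCoord_crude_le`), and the generic crude collapse
`…DiagDecorKappaCrudeCollapse.abs_collapseKappaCrude_le` (each `(log g)^t` piece `O(log^{t+(p−t)+(r₁+1)+r₂+1}M)`):

* `abs_shiftedCoordPrimeSq_crude_le` — the crude size of the `P₂`-coordinate;
* `abs_selbergBlockM4P2_le` — **the displayed crude block bound** (`0 ≤ λ ≤ 1`, `P₀ = P₁ = 0`, `M ≥ 3`).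

Remaining for (M4P2): `L = 2B + ℓ⁺₁ + ℓ⁺₂` and the `k₁ ↔ k₂` mirror (next file). Def-free; theorems only. Helper
`--supports stmt-Parity-20007`; closes nothing; K_A, K_B and the Parity summit are NOT proved; nothing about Landau–Siegel zeros.

## References
* E. Kowalski, P. Michel, J. VanderKam, J. reine angew. Math. 526 (2000), (23)–(28) pp. 13–15 and Prop. 5.1 p. 18.
  [cite: KowalskiMichelVanderKam2000, (23)–(28) — derivation (diagonal weight in real Selberg coordinates, mixed divisor-log moments)]
-/

noncomputable section

open scoped Real ArithmeticFunction.Moebius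
open Finset ArithmeticFunction Polynomial

namespace Summit.Parity.GeneralizedHardyLittlewood.Theorems.MomentsBeyondDiagonal.DiagKernel

open Literature.NumberTheory.LFunctions Literature.NumberTheory.LFunctions.KMV2000
open MollifierMainTerm (W)
open SelbergCoord (kappa)
open Literature.NumberTheory.Sieve (one_le_log_of_three_le)
open Summit.Parity.GeneralizedHardyLittlewood.Theorems.BeyondDiagonalBeatsQuarter.KernelFormXSq
  (divWeight divWeight_nonneg)

/-- **Crude size of the `P₂`-decorated shifted coordinate**: `|T_{P₂}^{[r]}(M;n)| ≤ K·D(n)·log^rM` (`P₀ = P₁ = 0`, `M ≥ 3`,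
`1 ≤ n ≤ M`). [cite: KowalskiMichelVanderKam2000, (23)–(28) — derivation] -/
theorem abs_shiftedCoordPrimeSq_crude_le (P : ℝ[X]) (hP0 : P.coeff 0 = 0) (hP1 : P.coeff 1 = 0) (r : ℕ) :
    ∃ K : ℝ, 0 ≤ K ∧ ∀ M : ℝ, 3 ≤ M → ∀ n : ℕ, n ≠ 0 → (n : ℝ) ≤ M →
      |∑ c ∈ Finset.range (P.natDegree + 1), P.coeff c *
          ((∑ k ∈ Icc 1 ⌊M / n⌋₊, (if k.Coprime n then W k else 0) *
              ((k.divisors.card : ℝ) * ∑ p ∈ k.primeFactors, Real.log p ^ 2) *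
            Real.log (M / n / k) ^ (c + r)) / Real.log M ^ c)| ≤
        K * divWeight n * Real.log M ^ r := by
  obtain ⟨C₂, hC₂, hT₂⟩ := abs_shiftedCoordPrimeSq_sub_le P hP0 hP1 r
  obtain ⟨K₂, hK₂, hb₂⟩ := abs_profileCoord_crude_le ((fun r' : ℕ ↦ -(2 : ℝ) • (X ^ r' * P)) r) 0
    (fun M n ↦ (∑ c ∈ Finset.range (P.natDegree + 1), P.coeff c *
      ((∑ k ∈ Icc 1 ⌊M / n⌋₊, (if k.Coprime n then W k else 0) *
          ((k.divisors.card : ℝ) * ∑ p ∈ k.primeFactors, Real.log p ^ 2) *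
        Real.log (M / n / k) ^ (c + r)) / Real.log M ^ c)) / Real.log M ^ r) hC₂ hT₂
  refine ⟨K₂, hK₂, fun M hM n hn hnM ↦ ?_⟩
  have hℓ1 : 1 ≤ Real.log M := one_le_log_of_three_le hM
  have hℓpos : 0 < Real.log M := by linarith
  have h' := hb₂ M hM n hn hnM
  rw [abs_div, abs_of_pos (pow_pos hℓpos r), div_le_iff₀ (pow_pos hℓpos r), pow_zero, div_one] at h'
  exact h'

/-- **The two-sided `M₄ ⊗ P₂` shifted block is `O(log^{p+r₁+r₂+2}M)`** (see the module docstring).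
[cite: KowalskiMichelVanderKam2000, (23)–(28) — derivation] -/
theorem abs_selbergBlockM4P2_le (P : ℝ[X]) (hP0 : P.coeff 0 = 0) (hP1 : P.coeff 1 = 0) (p r₁ r₂ : ℕ)
    {lam : ℝ} (hlam0 : 0 ≤ lam) (hlam1 : lam ≤ 1) :
    ∃ C : ℝ, 0 < C ∧ ∀ M : ℝ, 3 ≤ M →
      |∑ c ∈ Icc 1 ⌊M⌋₊, ∑ g ∈ Icc 1 (⌊M⌋₊ / c), (μ g : ℝ) * c *
          ∑ k₁ ∈ Icc 1 (⌊M⌋₊ / (c * g)), ∑ k₂ ∈ Icc 1 (⌊M⌋₊ / (c * g)),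
            ((μ (c * g * k₁) : ℝ) * ((psi (c * g * k₁))⁻¹ *
                P.eval (Real.log (M / ((c * g * k₁ : ℕ) : ℝ)) / Real.log M))) / ((c * g * k₁ : ℕ) : ℝ) *
              (((μ (c * g * k₂) : ℝ) * ((psi (c * g * k₂))⁻¹ *
                P.eval (Real.log (M / ((c * g * k₂ : ℕ) : ℝ)) / Real.log M))) / ((c * g * k₂ : ℕ) : ℝ)) *
              (((k₁.divisors.card : ℝ) *
                  (3 * (∑ q ∈ k₁.primeFactors, Real.log q ^ 2) ^ 2 - 2 * ∑ q ∈ k₁.primeFactors, Real.log q ^ 4) *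
                  Real.log (M / ((c * g : ℕ) : ℝ) / k₁) ^ r₁) *
                ((k₂.divisors.card : ℝ) * (∑ q ∈ k₂.primeFactors, Real.log q ^ 2) *
                  Real.log (M / ((c * g : ℕ) : ℝ) / k₂) ^ r₂) *
                (lam * Real.log M - Real.log g - Real.log (M / ((c * g : ℕ) : ℝ))) ^ p)| ≤
        C * Real.log M ^ (p + r₁ + r₂ + 2) := by
  -- crude coordinate sizes
  obtain ⟨K₁, hK₁, hb₁⟩ := abs_shiftedCoordM4_le P hP0 hP1 r₁
  obtain ⟨K₂, hK₂, hb₂⟩ := abs_shiftedCoordPrimeSq_crude_le P hP0 hP1 r₂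
  -- one constant per `t`
  have hex : ∀ t : ℕ, ∃ C : ℝ, 0 < C ∧ (t ≤ p → ∀ M : ℝ, 3 ≤ M →
      |∑ c ∈ Icc 1 ⌊M⌋₊, ∑ g ∈ Icc 1 (⌊M⌋₊ / c), (μ g : ℝ) * c * Real.log g ^ t * (W (c * g) ^ 2 *
          ((lam * Real.log M - Real.log (M / ((c * g : ℕ) : ℝ))) ^ (p - t) *
            (∑ c' ∈ Finset.range (P.natDegree + 1), P.coeff c' *
              ((∑ k ∈ Icc 1 ⌊M / ((c * g : ℕ) : ℝ)⌋₊, (if k.Coprime (c * g) then W k else 0) *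
                ((k.divisors.card : ℝ) *
                  (3 * (∑ q ∈ k.primeFactors, Real.log q ^ 2) ^ 2 - 2 * ∑ q ∈ k.primeFactors, Real.log q ^ 4)) *
                Real.log (M / ((c * g : ℕ) : ℝ) / k) ^ (c' + r₁)) / Real.log M ^ c')) *
            (∑ c' ∈ Finset.range (P.natDegree + 1), P.coeff c' *
              ((∑ k ∈ Icc 1 ⌊M / ((c * g : ℕ) : ℝ)⌋₊, (if k.Coprime (c * g) then W k else 0) *
                ((k.divisors.card : ℝ) * ∑ q ∈ k.primeFactors, Real.log q ^ 2) *
                Real.log (M / ((c * g : ℕ) : ℝ) / k) ^ (c' + r₂)) / Real.log M ^ c'))))| ≤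
        C * Real.log M ^ (p + r₁ + r₂ + 2)) := by
    intro t
    by_cases htp : t ≤ p
    · obtain ⟨C, hC, h⟩ := abs_collapseKappaCrude_le
        (fun M n ↦ ∑ c' ∈ Finset.range (P.natDegree + 1), P.coeff c' *
          ((∑ k ∈ Icc 1 ⌊M / n⌋₊, (if k.Coprime n then W k else 0) *
            ((k.divisors.card : ℝ) *
              (3 * (∑ q ∈ k.primeFactors, Real.log q ^ 2) ^ 2 - 2 * ∑ q ∈ k.primeFactors, Real.log q ^ 4)) *
            Real.log (M / n / k) ^ (c' + r₁)) / Real.log M ^ c'))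
        (fun M n ↦ ∑ c' ∈ Finset.range (P.natDegree + 1), P.coeff c' *
          ((∑ k ∈ Icc 1 ⌊M / n⌋₊, (if k.Coprime n then W k else 0) *
            ((k.divisors.card : ℝ) * ∑ q ∈ k.primeFactors, Real.log q ^ 2) *
            Real.log (M / n / k) ^ (c' + r₂)) / Real.log M ^ c'))
        (r₁ + 1) r₂ hK₁ hK₂ hb₁ hb₂ t (p - t) hlam0 hlam1
      refine ⟨C, hC, fun _ M hM ↦ ?_⟩
      have h' := h M hM
      rw [show t + (p - t) + (r₁ + 1) + r₂ + 1 = p + r₁ + r₂ + 2 by omega] at h'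
      exact h'
    · exact ⟨1, one_pos, fun h ↦ absurd h htp⟩
  choose Ct hCt0 hCt using hex
  set K : ℝ := ∑ t ∈ Finset.range (p + 1), (p.choose t : ℝ) * Ct t with hK
  have hK0 : 0 ≤ K := Finset.sum_nonneg fun t _ ↦ by have := hCt0 t; positivity
  refine ⟨K + 1, by positivity, fun M hM ↦ ?_⟩
  have hℓ1 : 1 ≤ Real.log M := one_le_log_of_three_le hM
  have hx := selbergBlockDecorTwo_expand
    (fun k : ℕ ↦ 3 * (∑ q ∈ k.primeFactors, Real.log q ^ 2) ^ 2 - 2 * ∑ q ∈ k.primeFactors, Real.log q ^ 4)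
    (fun k : ℕ ↦ ∑ q ∈ k.primeFactors, Real.log q ^ 2) P M lam p r₁ r₂
  beta_reduce at hx
  rw [hx]
  have hterm : ∀ t ∈ Finset.range (p + 1), |(p.choose t : ℝ) * (-1) ^ t *
      ∑ c ∈ Icc 1 ⌊M⌋₊, ∑ g ∈ Icc 1 (⌊M⌋₊ / c), (μ g : ℝ) * c * Real.log g ^ t * (W (c * g) ^ 2 *
          ((lam * Real.log M - Real.log (M / ((c * g : ℕ) : ℝ))) ^ (p - t) *
            (∑ c' ∈ Finset.range (P.natDegree + 1), P.coeff c' *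
              ((∑ k ∈ Icc 1 ⌊M / ((c * g : ℕ) : ℝ)⌋₊, (if k.Coprime (c * g) then W k else 0) *
                ((k.divisors.card : ℝ) *
                  (3 * (∑ q ∈ k.primeFactors, Real.log q ^ 2) ^ 2 - 2 * ∑ q ∈ k.primeFactors, Real.log q ^ 4)) *
                Real.log (M / ((c * g : ℕ) : ℝ) / k) ^ (c' + r₁)) / Real.log M ^ c')) *
            (∑ c' ∈ Finset.range (P.natDegree + 1), P.coeff c' *
              ((∑ k ∈ Icc 1 ⌊M / ((c * g : ℕ) : ℝ)⌋₊, (if k.Coprime (c * g) then W k else 0) *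
                ((k.divisors.card : ℝ) * ∑ q ∈ k.primeFactors, Real.log q ^ 2) *
                Real.log (M / ((c * g : ℕ) : ℝ) / k) ^ (c' + r₂)) / Real.log M ^ c'))))| ≤
        (p.choose t : ℝ) * Ct t * Real.log M ^ (p + r₁ + r₂ + 2) := by
    intro t ht
    have htp : t ≤ p := Nat.lt_succ_iff.1 (Finset.mem_range.1 ht)
    have h := hCt t htp M hM
    rw [abs_mul, abs_mul, abs_pow, abs_neg, abs_one, one_pow, mul_one,
      abs_of_nonneg (by positivity : (0 : ℝ) ≤ (p.choose t : ℝ)), mul_assoc]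
    exact mul_le_mul_of_nonneg_left h (by positivity)
  calc _ ≤ ∑ t ∈ Finset.range (p + 1), (p.choose t : ℝ) * Ct t * Real.log M ^ (p + r₁ + r₂ + 2) :=
        (Finset.abs_sum_le_sum_abs _ _).trans (Finset.sum_le_sum hterm)
    _ = K * Real.log M ^ (p + r₁ + r₂ + 2) := by rw [hK, Finset.sum_mul]
    _ ≤ (K + 1) * Real.log M ^ (p + r₁ + r₂ + 2) := by gcongr; linarith

end Summit.Parity.GeneralizedHardyLittlewood.Theorems.MomentsBeyondDiagonal.DiagKernel

end
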